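import Mathlib.RingTheory.MvPolynomial.Homogeneous
import Mathlib.Algebra.MvPolynomial.Monad
import Mathlib.Algebra.MvPolynomial.CommRing
import Mathlib.Algebra.Ring.GeomSum
import Mathlib.Data.Fin.VecNotation
import Mathlib.Tactic.Ring

/-!
# Taylor side of the branch obstruction (K-β7-alg block (e-alg), file 2 of 2; W4.1, OURS)

Companion of `…SteerTranslationInvariantForm` (memo `CANONICAL-CLEANING-g10.md` §12.3 step (4) of
res-L0-w41-idea-1, «TAYLOR–HASSE»). Hasse derivatives of a binary form `Φ ∈ K[Z, W]` at a point
`t = (t₁, t₂)` are presented as the Taylor coefficients of the translated polynomial `Φ(Z + t₁, W + t₂)`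
(the coefficient of `Z^i W^j` is `(Δ_{(i,j)} Φ)(t)`), so no Hasse-derivative API is needed on the binary-form
side: **if `Φ` is homogeneous of degree `n` and every coefficient of degree `< n` of `Φ(Z + t₁, W + t₂)`
vanishes, then `Φ(Z + t₁, W + t₂) = Φ(Z, W)`** (`transl_eq_self_of_coeff_eq_zero`; any field, any
characteristic) — the hypothesis of `TranslationInvariant.eq_C_mul_linearPow_of_translation_invariant`.
Route: translating a monomial of degree `n ≥ 1` changes it by terms of total degree `< n`
(`geom_sum₂_mul` on `(X i + t)^a − X i^a`), so `Φ(Z + t₁, W + t₂) − Φ` has total degree `< n`, and its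
low coefficients are exactly the hypothesis.

Everything here is OURS (the run's own bookkeeping), AI-written and AI-checked only — weaker than expert
review; nothing is a statement of [Hironaka2017]. -/

set_option linter.dupNamespace false
set_option autoImplicit false

namespace Summit.ResolutionOfSingularities.ResolutionOfSingularities.Theorems.SwitchingDichotomy.TranslationTaylor

open MvPolynomial

variable {K : Type*} [Field K]

/-- A monomial in two variables, spelled out. -/
theorem monomial_fin_two (m : Fin 2 →₀ ℕ) (c : K) :
    (monomial m c : MvPolynomial (Fin 2) K) = C c * (X 0 ^ (m 0) * X 1 ^ (m 1)) := by
  rw [monomial_eq, Finsupp.prod_fintype _ _ (fun i => by simp), Fin.prod_univ_two]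

/-- The linear form `X i + t` has total degree `≤ 1`. -/
theorem totalDegree_X_add_C_le (i : Fin 2) (t : K) :
    ((X i + C t : MvPolynomial (Fin 2) K)).totalDegree ≤ 1 := by
  refine (totalDegree_add _ _).trans ?_
  rw [totalDegree_X, totalDegree_C]
  simp

/-- `(X i + t)^a − X i^a` has total degree `< a` (for `a ≥ 1`): the top term cancels. -/
theorem totalDegree_linearPow_sub_lt (i : Fin 2) (t : K) {a : ℕ} (ha : 1 ≤ a) :
    ((X i + C t) ^ a - X i ^ a : MvPolynomial (Fin 2) K).totalDegree < a := by
  have hgeom := geom_sum₂_mul (X i + C t : MvPolynomial (Fin 2) K) (X i) a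
  rw [show (X i + C t - X i : MvPolynomial (Fin 2) K) = C t by ring] at hgeom
  rw [← hgeom]
  refine (totalDegree_mul _ _).trans_lt ?_
  rw [totalDegree_C, add_zero]
  refine (totalDegree_finsetSum _ _).trans_lt ?_
  rw [Finset.sup_lt_iff (by rw [bot_eq_zero]; omega)]
  intro k hk
  rw [Finset.mem_range] at hk
  refine (totalDegree_mul _ _).trans_lt ?_
  have h1 : ((X i + C t : MvPolynomial (Fin 2) K) ^ k).totalDegree ≤ k := by
    refine (totalDegree_pow _ _).trans ?_
    have := totalDegree_X_add_C_le i t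
    calc k * (X i + C t : MvPolynomial (Fin 2) K).totalDegree ≤ k * 1 := Nat.mul_le_mul_left k this
      _ = k := mul_one k
  have h2 : ((X i : MvPolynomial (Fin 2) K) ^ (a - 1 - k)).totalDegree ≤ a - 1 - k := by
    refine (totalDegree_pow _ _).trans ?_
    rw [totalDegree_X, mul_one]
  omega

/-- For a monomial of degree `n ≥ 1`, translating the variables changes it by terms of degree `< n`. -/
theorem totalDegree_transl_monomial_sub_lt (t₁ t₂ : K) (a b : ℕ) (hab : 1 ≤ a + b) :
    ((X 0 + C t₁) ^ a * (X 1 + C t₂) ^ b - X 0 ^ a * X 1 ^ b : MvPolynomial (Fin 2) K).totalDegree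
      < a + b := by
  set P : MvPolynomial (Fin 2) K := X 0 + C t₁ with hP
  set Q : MvPolynomial (Fin 2) K := X 1 + C t₂ with hQ
  have hsplit : P ^ a * Q ^ b - X 0 ^ a * X 1 ^ b = (P ^ a - X 0 ^ a) * Q ^ b + X 0 ^ a * (Q ^ b - X 1 ^ b) := by
    ring
  rw [hsplit]
  have hQb : (Q ^ b).totalDegree ≤ b := by
    refine (totalDegree_pow _ _).trans ?_
    calc b * Q.totalDegree ≤ b * 1 := Nat.mul_le_mul_left b (totalDegree_X_add_C_le 1 t₂)
      _ = b := mul_one b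
  have hXa : ((X 0 : MvPolynomial (Fin 2) K) ^ a).totalDegree ≤ a := by
    refine (totalDegree_pow _ _).trans ?_
    rw [totalDegree_X, mul_one]
  refine (totalDegree_add _ _).trans_lt ?_
  rw [max_lt_iff]
  constructor
  · by_cases ha : a = 0
    · subst ha
      simp only [pow_zero, sub_self, zero_mul, totalDegree_zero]
      omega
    · have h1 := totalDegree_linearPow_sub_lt (0 : Fin 2) t₁ (Nat.one_le_iff_ne_zero.mpr ha)
      refine (totalDegree_mul _ _).trans_lt ?_
      rw [← hP] at h1
      omega
  · by_cases hb : b = 0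
    · subst hb
      simp only [pow_zero, sub_self, mul_zero, totalDegree_zero]
      omega
    · have h1 := totalDegree_linearPow_sub_lt (1 : Fin 2) t₂ (Nat.one_le_iff_ne_zero.mpr hb)
      refine (totalDegree_mul _ _).trans_lt ?_
      rw [← hQ] at h1
      omega

/-- Translating a form of degree `n ≥ 1` changes it by terms of degree `< n`. -/
theorem totalDegree_transl_sub_lt {n : ℕ} (hn : 1 ≤ n) {Φ : MvPolynomial (Fin 2) K}
    (hΦ : Φ.IsHomogeneous n) (t₁ t₂ : K) :
    (bind₁ ![X 0 + C t₁, X 1 + C t₂] Φ - Φ).totalDegree < n := by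
  classical
  have hexp : bind₁ ![X 0 + C t₁, X 1 + C t₂] Φ - Φ =
      ∑ m ∈ Φ.support, C (coeff m Φ) *
        ((X 0 + C t₁) ^ (m 0) * (X 1 + C t₂) ^ (m 1) - X 0 ^ (m 0) * X 1 ^ (m 1)) := by
    conv_lhs => rw [Φ.as_sum]
    rw [map_sum, ← Finset.sum_sub_distrib]
    refine Finset.sum_congr rfl (fun m _ => ?_)
    rw [monomial_fin_two, map_mul, bind₁_C_right, map_mul, map_pow, map_pow, bind₁_X_right,
      bind₁_X_right]
    simp only [Matrix.cons_val_zero, Matrix.cons_val_one]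
    ring
  rw [hexp]
  refine (totalDegree_finsetSum _ _).trans_lt ?_
  rw [Finset.sup_lt_iff (by rw [bot_eq_zero]; omega)]
  intro m hm
  have hdeg : m 0 + m 1 = n := by
    have h := hΦ (mem_support_iff.mp hm)
    simpa [Finsupp.weight_apply, Finsupp.sum_fintype, Fin.sum_univ_two] using h
  refine (totalDegree_mul _ _).trans_lt ?_
  rw [totalDegree_C, zero_add, ← hdeg]
  exact totalDegree_transl_monomial_sub_lt t₁ t₂ (m 0) (m 1) (by omega)

/-- **Taylor side of §12.3 step (4)** (Hasse derivatives at `t` presented as Taylor coefficients; any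
field, any characteristic): if `Φ ∈ K[Z, W]` is homogeneous of degree `n` and EVERY coefficient of degree
`< n` of the translated polynomial `Φ(Z + t₁, W + t₂)` vanishes, then `Φ(Z + t₁, W + t₂) = Φ(Z, W)` — the
hypothesis of `eq_C_mul_linearPow_of_translation_invariant`. (The coefficient of `Z^i W^j` in
`Φ(Z + t₁, W + t₂)` is the Hasse derivative `(Δ_{(i,j)} Φ)(t₁, t₂)`.) OURS. -/
theorem transl_eq_self_of_coeff_eq_zero {n : ℕ} {Φ : MvPolynomial (Fin 2) K} (hΦ : Φ.IsHomogeneous n)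
    (t₁ t₂ : K)
    (h : ∀ d : Fin 2 →₀ ℕ, d 0 + d 1 < n → coeff d (bind₁ ![X 0 + C t₁, X 1 + C t₂] Φ) = 0) :
    bind₁ ![X 0 + C t₁, X 1 + C t₂] Φ = Φ := by
  classical
  by_cases hn : n = 0
  · -- a form of degree `0` is a constant
    subst hn
    have hΦC : Φ = C (coeff 0 Φ) := by
      rw [← totalDegree_eq_zero_iff_eq_C]
      exact Nat.le_zero.mp hΦ.totalDegree_le
    rw [hΦC, bind₁_C_right]
  have hn1 : 1 ≤ n := Nat.one_le_iff_ne_zero.mpr hn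
  rw [← sub_eq_zero]
  ext d
  rw [coeff_zero]
  by_cases hd : d 0 + d 1 < n
  · rw [coeff_sub, h d hd, hΦ.coeff_eq_zero (by rw [Finsupp.degree_eq_sum, Fin.sum_univ_two]; omega), sub_zero]
  · apply coeff_eq_zero_of_totalDegree_lt
    have hlt := totalDegree_transl_sub_lt hn1 hΦ t₁ t₂
    rw [← Finsupp.degree_apply, Finsupp.degree_eq_sum, Fin.sum_univ_two]
    omega

end Summit.ResolutionOfSingularities.ResolutionOfSingularities.Theorems.SwitchingDichotomy.TranslationTaylor
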